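import Mathlib
import Summits.Ventures.PercRepro2.Defs
import Summits.Ventures.PercRepro2.Independence
import Summits.Ventures.PercRepro2.Harris
import Summits.Ventures.PercRepro2.Graph
import Summits.Ventures.PercRepro2.Exploration
import Summits.Ventures.PercRepro2.Events
import Summits.Ventures.PercRepro2.FourFunctions
import Summits.Ventures.PercRepro2.Induced
import Summits.Ventures.PercRepro2.Frontier
import Summits.Ventures.PercRepro2.ObsIndependence
import Summits.Ventures.PercRepro2.BHK
import Summits.Ventures.PercRepro2.BHKEvents
import Summits.Ventures.PercRepro2.MultiSource
import Summits.Ventures.PercRepro2.OrderPreservation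
import Summits.Ventures.PercRepro2.SeedSet
import Summits.Ventures.PercRepro2.MultiSourceFun
import Summits.Ventures.PercRepro2.CrossRootT
import Summits.Ventures.PercRepro2.VdBKahn
import Summits.Ventures.PercRepro2.HullDefs
import Summits.Ventures.PercRepro2.CCTRootEdge
import Summits.Ventures.PercRepro2.CCTAvoidedEdge
import Summits.Ventures.PercRepro2.R1Rung
import Summits.Ventures.PercRepro2.CC2Rung
import Summits.Ventures.PercRepro2.PASubDefs
import Summits.Ventures.PercRepro2.PASub
import Summits.Ventures.PercRepro2.HalfN
import Summits.Ventures.PercRepro2.CCTLin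
import Summits.Ventures.PercRepro2.LemmaA
import Summits.Ventures.PercRepro2.OneEdge
import Summits.Ventures.PercRepro2.GateDefs
import Summits.Ventures.PercRepro2.GateFrame
import Summits.Ventures.PercRepro2.GateSFrame
import Summits.Ventures.PercRepro2.CCTMarkerFrame

/-!
# THEOREM: the rung (CC-T) holds at every edge incident to a marker (blind cell PercRepro2,
typer-1; mine-c g6 MINE-C.md §13.13, INBOX 2026-08-23T16:49:56Z; lead g11 16:50:33Z
"`CC2_marker_edge` after GateRow_markerB")

At `e = {a, w}` with `a` the marker of `X`, in the `e`-closed law `p₀ = p[e ↦ 0]` (every mass of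
`TwoSetRung.CC2` is a `p₀`-probability: the `e`-open events `X⁺, Y⁺, R⁺` do not look at `e`), the
`e`-open avoidance decomposes as `R⁺ = E₁ ⊔ E₂` with `E₁ = R_T ∩ {S hits W} ∩ {K avoids W}`,
`E₂ = R_{T ∪ W}` (`W = {a, w}`; `CCTMarkerFrame.Rplus_eq_marker_edge`): on `E₁` the merged marker
event is sure (`X⁺ = 1`) and `Y⁺ ⊇ Y`; on `E₂` nothing merges (`X⁺ = 0`, `Y⁺ = Y`). With
`r = P(R_T)`, `x = P(X; R_T)`, `y = P(Y; R_T)` the cleared rung is EXACTLY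

  `(r − x) · (r · P(Y⁺; E₁) − y · P(E₁)) + x · (y · P(E₂) − r · P(Y; E₂))`   (`cc2_marker_identity`),

the second term `≥ 0` by the avoided-set monotonicity (`LemmaA.shift_avoid_more`, mine-c's
`m_X · E[m_Y − Y; R_{T∪W}]`), the first since `P(Y⁺; E₁) ≥ P(Y; E₁)` and
`E[Y | S hits W, K avoids W] ≥ E[Y | K avoids W] ≥ E[Y | R_T]` (`hull_frame_pa_gen` with the
increasing `{S hits W}`, and `GateFrame.hits_Y_le`).

* **`CC2_marker_edge`**: `TwoSetRung.CC2 p ends e s {a} {b} T T` for every admissible `p` and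
  every edge `e = {a, w}`; **`CC2_marker_edge'`** for `e = {b, w}`. With the cell's theorems at
  root edges, `T`-edges and unmarked pendant edges: (CC-T) is proved at every edge except those
  whose two endpoints are free non-markers (mine-c §13.13, the sentence of record for the rung).
-/

namespace Summit.Ventures.PercRepro2

namespace CCTMarker

open scoped Classical

variable {V : Type*} {E : Type*} [Fintype E] [DecidableEq E] [Fintype V] [DecidableEq V]
  {R : Type*} [Field R] [LinearOrder R] [IsStrictOrderedRing R]

variable (p : E → R) (ends : E → Sym2 V) (e : E) (s : V) (T : Finset V) (a b w : V)

omit [Fintype V] [DecidableEq V] [LinearOrder R] [IsStrictOrderedRing R] in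
/-- An event that does not look at `e` has the same probability under `p` and `p[e ↦ 0]`. -/
lemma prob_eq_update_zero_of_indep (A : Set (Config E))
    (hA : ∀ ω : Config E, Function.update ω e false ∈ A ↔ ω ∈ A) :
    prob p A = prob (Function.update p e 0) A := by
  rw [CCT.prob_update_zero_eq]
  congr 1
  ext ω
  exact (hA ω).symm

omit [Fintype E] [DecidableEq E] [Fintype V] [DecidableEq V] in
/-- `{S hits W}` as a cluster event. -/
lemma clusterInEvent_hits_eq (W : Finset V) :
    clusterInEvent ends s {S' : Set V | ∃ u ∈ W, u ∈ S'} = Gate.hitsS ends s W := by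
  ext ω
  simp [clusterInEvent, Gate.hitsS, mem_cluster]

omit [Fintype E] [DecidableEq E] [Fintype V] [DecidableEq V] in
/-- `{S hits W} ∩ {b ∈ S}` as a cluster event. -/
lemma clusterInEvent_hits_inter_eq (W : Finset V) :
    clusterInEvent ends s ({S' : Set V | ∃ u ∈ W, u ∈ S'} ∩ {S' | b ∈ S'}) =
      Gate.hitsS ends s W ∩ connAll ends s {b} := by
  ext ω
  simp [clusterInEvent, Gate.hitsS, connAll, mem_cluster]

omit [DecidableEq V] [LinearOrder R] [IsStrictOrderedRing R] in
/-- The exact identity of the marker-edge rung. -/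
lemma cc2_marker_identity (r x y e₁ e₂ y₁ y₂ : R) :
    y₁ * r ^ 2 + x * y * (e₁ + e₂) - r * (e₁ * y + x * (y₁ + y₂)) =
      (r - x) * (r * y₁ - y * e₁) + x * (y * e₂ - r * y₂) := by
  ring

/-- **THEOREM (CC-T at a marker edge)** (mine-c §13.13): `TwoSetRung.CC2 p ends e s {a} {b} T T`
for every admissible `p` and every edge `e = {a, w}`. -/
theorem CC2_marker_edge (hp : IsProbVec p) (hends : ends e = s(a, w)) :
    TwoSetRung.CC2 p ends e s {a} {b} T T := by
  unfold TwoSetRung.CC2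
  rw [Finset.union_self, Finset.inter_self, CCTLin.massF_update_one_eq,
    CCTLin.massF_update_one_eq, CCTLin.massF_update_one_pair_eq, CCTLin.massP_update_one_eq]
  have hp₀ : IsProbVec (Function.update p e 0) := hp.update e le_rfl zero_le_one
  -- the `e`-open events do not look at `e`: pass to `p₀`
  have hidem : ∀ ω : Config E, Function.update (Function.update ω e false) e true =
      Function.update ω e true := fun ω => Function.update_idem false true ω
  have hXp : ∀ ω : Config E, Function.update ω e false ∈ CCTLin.Xplus ends e s a ↔
      ω ∈ CCTLin.Xplus ends e s a := by
    intro ω; simp only [CCTLin.Xplus, Set.mem_setOf_eq, hidem]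
  have hYp : ∀ ω : Config E, Function.update ω e false ∈ CCTLin.Xplus ends e s b ↔
      ω ∈ CCTLin.Xplus ends e s b := by
    intro ω; simp only [CCTLin.Xplus, Set.mem_setOf_eq, hidem]
  have hRp : ∀ ω : Config E, Function.update ω e false ∈ PASub.Rplus ends e s T ↔
      ω ∈ PASub.Rplus ends e s T := by
    intro ω; simp only [PASub.Rplus, Set.mem_setOf_eq, hidem]
  rw [prob_eq_update_zero_of_indep p e (CCTLin.Xplus ends e s a ∩ PASub.Rplus ends e s T)
      (fun ω => by rw [Set.mem_inter_iff, Set.mem_inter_iff, hXp, hRp]),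
    prob_eq_update_zero_of_indep p e (CCTLin.Xplus ends e s b ∩ PASub.Rplus ends e s T)
      (fun ω => by rw [Set.mem_inter_iff, Set.mem_inter_iff, hYp, hRp]),
    prob_eq_update_zero_of_indep p e
      (CCTLin.Xplus ends e s a ∩ CCTLin.Xplus ends e s b ∩ PASub.Rplus ends e s T)
      (fun ω => by
        rw [Set.mem_inter_iff, Set.mem_inter_iff, Set.mem_inter_iff, Set.mem_inter_iff, hXp, hYp,
          hRp]),
    prob_eq_update_zero_of_indep p e (PASub.Rplus ends e s T) hRp]
  unfold TwoSetRung.massP TwoSetRung.massF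
  set p₀ := Function.update p e 0 with hp₀def
  -- the decomposition `R⁺ = E₁ ⊔ E₂`
  rw [Rplus_eq_marker_edge ends e s T a w hends]
  set W : Finset V := {a, w} with hW
  set Rt := avoidAll ends s T with hRt
  set hS := Gate.hitsS ends s W with hhS
  set hK := Gate.hitsK ends T W with hhK
  set E₁ := Rt ∩ hS ∩ hKᶜ with hE₁
  set E₂ := Rt ∩ hSᶜ with hE₂
  set Xp := CCTLin.Xplus ends e s a with hXpdef
  set Yp := CCTLin.Xplus ends e s b with hYpdef
  set Y := connAll ends s {b} with hY
  have hXS : ∀ ω, ω ∈ Xp ↔ ω ∈ hS := fun ω => Xplus_iff_hitsS ends e s a w hends ω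
  have hYmem : ∀ ω, ω ∈ Y ↔ Conn ends ω s b := fun ω => by simp [hY, connAll]
  have hYY : Y ⊆ Yp := fun ω h => Y_subset_Yplus ends e s b ω ((hYmem ω).1 h)
  have hYE : ∀ ω, ω ∉ hS → (ω ∈ Yp ↔ ω ∈ Y) := fun ω h => by
    rw [hYmem]
    exact Yplus_iff_of_not_hitsS ends e s a b w hends ω h
  have eG : Gate.gateEvent ends s T W W = E₁ ∪ E₂ := by
    ext ω
    simp only [Gate.gateEvent, hE₁, hE₂, Set.mem_inter_iff, Set.mem_union, Set.mem_compl_iff,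
      not_and]
    tauto
  have hdisj : Disjoint E₁ E₂ := by
    rw [Set.disjoint_left]
    rintro ω ⟨⟨_, hs⟩, _⟩ ⟨_, hns⟩
    exact hns hs
  -- the four `e`-open masses
  have eX : Xp ∩ Gate.gateEvent ends s T W W = E₁ := by
    rw [eG]
    ext ω
    simp only [hE₁, hE₂, Set.mem_inter_iff, Set.mem_union, Set.mem_compl_iff, hXS]
    tauto
  have eXY : Xp ∩ Yp ∩ Gate.gateEvent ends s T W W = Yp ∩ E₁ := by
    rw [eG]
    ext ω
    simp only [hE₁, hE₂, Set.mem_inter_iff, Set.mem_union, Set.mem_compl_iff, hXS]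
    tauto
  have eY : prob p₀ (Yp ∩ Gate.gateEvent ends s T W W) = prob p₀ (Yp ∩ E₁) + prob p₀ (Y ∩ E₂) := by
    have h1 : Yp ∩ Gate.gateEvent ends s T W W = (Yp ∩ E₁) ∪ (Y ∩ E₂) := by
      rw [eG, Set.inter_union_distrib_left]
      congr 1
      ext ω
      simp only [hE₂, Set.mem_inter_iff, Set.mem_compl_iff]
      constructor
      · rintro ⟨hy, hR, hns⟩; exact ⟨(hYE ω hns).1 hy, hR, hns⟩
      · rintro ⟨hy, hR, hns⟩; exact ⟨(hYE ω hns).2 hy, hR, hns⟩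
    rw [h1, prob_union_of_disjoint]
    exact Set.disjoint_of_subset Set.inter_subset_right Set.inter_subset_right hdisj
  have eR : prob p₀ (Gate.gateEvent ends s T W W) = prob p₀ E₁ + prob p₀ E₂ := by
    rw [eG, prob_union_of_disjoint p₀ hdisj]
  rw [eX, eXY, eY, eR]
  -- names
  set r := prob p₀ Rt with hr
  set x := prob p₀ (Rt ∩ connAll ends s {a}) with hx
  set y := prob p₀ (Rt ∩ Y) with hy
  set e₁ := prob p₀ E₁ with he₁
  set e₂ := prob p₀ E₂ with he₂
  set y₁ := prob p₀ (Yp ∩ E₁) with hy₁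
  set y₂ := prob p₀ (Y ∩ E₂) with hy₂
  rw [← sub_nonneg, cc2_marker_identity]
  -- term B: the avoided-set monotonicity on `E₂ = R_{T ∪ W}`
  have hE₂' : E₂ = avoidAll ends s (T ∪ W) := by
    rw [hE₂, Gate.avoidAll_union_eq, hhS, Gate.hitsS_eq_compl, compl_compl]
  have hB : 0 ≤ y * e₂ - r * y₂ := by
    have h := MineCLemmas.shift_avoid_more p₀ ends hp₀ s {b} T W
    rw [Set.inter_comm (connAll ends s {b}) (avoidAll ends s (T ∪ W)),
      Set.inter_comm (connAll ends s {b}) (avoidAll ends s T), ← hE₂'] at h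
    rw [hy₂, Set.inter_comm Y E₂]
    linarith [h]
  -- term A: `P(Y⁺; E₁) ≥ P(Y; E₁)` and the hull-frame chain
  have hA : 0 ≤ r * y₁ - y * e₁ := by
    have hY₁ : prob p₀ (Y ∩ E₁) ≤ y₁ := prob_mono hp₀ (Set.inter_subset_inter_left _ hYY)
    have hE₁' : E₁ = hS ∩ (Rt ∩ hKᶜ) := by
      rw [hE₁]; ext ω; simp only [Set.mem_inter_iff]; tauto
    -- (i) positive association of `{S hits W}` and `Y` given `R′ = R_T ∩ {K avoids W}`
    have hpa := hull_frame_pa_gen p₀ ends s T W hp₀ (𝓥₁ := {S' : Set V | ∃ u ∈ W, u ∈ S'})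
      (𝓥₂ := {S' : Set V | b ∈ S'}) (fun _ _ h ⟨u, hu, huS⟩ => ⟨u, hu, h huS⟩)
      (fun _ _ h hb => h hb)
    rw [clusterInEvent_hits_eq, Gate.clusterInEvent_mem_eq, clusterInEvent_hits_inter_eq] at hpa
    -- (ii) `Y` and `{K hits W}` are negatively correlated given `R_T`
    have hii := Gate.hits_Y_le p₀ ends s T W b hp₀
    have eYR : prob p₀ (Y ∩ (Rt ∩ hKᶜ)) = y - prob p₀ (hK ∩ Y ∩ Rt) := by
      have h := prob_inter_add_prob_inter_compl p₀ (Y ∩ Rt) hK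
      have e1 : Y ∩ Rt ∩ hK = hK ∩ Y ∩ Rt := by ext ω; simp only [Set.mem_inter_iff]; tauto
      have e2 : Y ∩ Rt ∩ hKᶜ = Y ∩ (Rt ∩ hKᶜ) := Set.inter_assoc _ _ _
      rw [e1, e2] at h
      rw [hy, Set.inter_comm Rt Y]
      linear_combination h
    have eRR : prob p₀ (Rt ∩ hKᶜ) = r - prob p₀ (hK ∩ Rt) := by
      have h := prob_inter_add_prob_inter_compl p₀ Rt hK
      rw [Set.inter_comm Rt hK] at h
      linear_combination h
    have hYp' : prob p₀ (hS ∩ Y ∩ (Rt ∩ hKᶜ)) = prob p₀ (Y ∩ E₁) := by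
      rw [hE₁']; congr 1; ext ω; simp only [Set.mem_inter_iff]; tauto
    have hE₁p : prob p₀ (hS ∩ (Rt ∩ hKᶜ)) = e₁ := by rw [he₁, hE₁']
    rw [hYp', hE₁p] at hpa
    -- the chain: `P(Y E₁) · P(R′) · r ≥ e₁ · P(Y; R′) · r ≥ e₁ · y · P(R′)`
    have hyc : prob p₀ (Y ∩ Rt) = y := by rw [hy, Set.inter_comm]
    have hyR : y * prob p₀ (Rt ∩ hKᶜ) ≤ prob p₀ (Y ∩ (Rt ∩ hKᶜ)) * r := by
      rw [eYR, eRR]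
      rw [hyc] at hii
      nlinarith [hii]
    have hR'0 : 0 ≤ prob p₀ (Rt ∩ hKᶜ) := prob_nonneg hp₀ _
    have he₁0 : 0 ≤ e₁ := prob_nonneg hp₀ _
    have hr0 : 0 ≤ r := prob_nonneg hp₀ _
    have hy0 : 0 ≤ y := prob_nonneg hp₀ _
    have hYE₁0 : 0 ≤ prob p₀ (Y ∩ E₁) := prob_nonneg hp₀ _
    have he₁R : e₁ ≤ prob p₀ (Rt ∩ hKᶜ) := by
      rw [he₁, hE₁']; exact prob_mono hp₀ Set.inter_subset_right
    rcases hR'0.lt_or_eq with hpos | hzero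
    · have h1 : e₁ * y * prob p₀ (Rt ∩ hKᶜ) ≤ prob p₀ (Y ∩ E₁) * prob p₀ (Rt ∩ hKᶜ) * r := by
        calc e₁ * y * prob p₀ (Rt ∩ hKᶜ) = e₁ * (y * prob p₀ (Rt ∩ hKᶜ)) := by ring
          _ ≤ e₁ * (prob p₀ (Y ∩ (Rt ∩ hKᶜ)) * r) := mul_le_mul_of_nonneg_left hyR he₁0
          _ = (e₁ * prob p₀ (Y ∩ (Rt ∩ hKᶜ))) * r := by ring
          _ ≤ (prob p₀ (Y ∩ E₁) * prob p₀ (Rt ∩ hKᶜ)) * r := mul_le_mul_of_nonneg_right hpa hr0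
      have h2 : 0 ≤ prob p₀ (Rt ∩ hKᶜ) * (r * prob p₀ (Y ∩ E₁) - y * e₁) := by nlinarith [h1]
      have h3 : 0 ≤ r * prob p₀ (Y ∩ E₁) - y * e₁ := nonneg_of_mul_nonneg_right h2 hpos
      have h4 := mul_le_mul_of_nonneg_left hY₁ hr0
      linarith
    · have he₁' : e₁ = 0 := le_antisymm (hzero ▸ he₁R) he₁0
      rw [he₁', mul_zero, sub_zero]
      exact mul_nonneg hr0 (prob_nonneg hp₀ _)
  have hxr : x ≤ r := prob_mono hp₀ Set.inter_subset_left
  have hx0 : 0 ≤ x := prob_nonneg hp₀ _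
  exact add_nonneg (mul_nonneg (sub_nonneg.2 hxr) hA) (mul_nonneg hx0 hB)

/-- (CC-T) at an edge incident to the marker `b`: `TwoSetRung.CC2 p ends e s {a} {b} T T` for
`e = {b, w}` (by the `a ↔ b` symmetry of the rung). -/
theorem CC2_marker_edge' (hp : IsProbVec p) (hends : ends e = s(b, w)) :
    TwoSetRung.CC2 p ends e s {a} {b} T T := by
  have h := CC2_marker_edge p ends e s T b a w hp hends
  unfold TwoSetRung.CC2 at h ⊢
  rw [Finset.union_comm {b} {a}] at h
  linarith [h]

end CCTMarker

end Summit.Ventures.PercRepro2
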